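import Mathlib
import Summits.RiemannHypothesis.RiemannHypothesis.Theorems.WeilFarFloorResidualCeilingRH
import HarnessLib

/-!
# The second-order UPPER bound for one Weil test: the exact `2 × 2` block along the cosh profile (under RH)

Helper file (`--supports stmt-RiemannHypothesis-0098`, lead-track anchor: Weil-positivity window ladder, format-C far bound),
pure proofs.  Seat rh-explicit-weil-1 gen15 (memo `run/shared/lean/pub/rh-explicit/rh-explicit-weil-1/FORMAT-K3.md` §16).

THE ESTIMATE (`primeShiftForm_le_coshQuotient_secondOrder_of_RH`).  Profile window `b₁ ≥ 4`, test window `b₂` with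
`b₂ ≥ b₁ + s²`; `u` a real Weil test on `[−b₂, b₂]` in the linear-modulus class `D_t(u) ≤ (|t|/h)N`, `∫u² ≤ N`;
weight sum `W` of the window `b₂`, an approximate eigenvalue `0 ≤ λ₀ ≤ τ` of the cosh profile `C = C_{b₁}` with coupling budget
`∫_{(−b₁,b₁)}(T_{b₁}C − λ₀C)² ≤ J_c·‖C‖²`, `P₊ ≥ b₂ + sinh b₂`, and the largeness condition `L + 1 ≤ R_c(b₁)`,
`L = 4(‖C‖²+3)s² + 8(b₂ − b₁)P₊ + 4Ψ(ηh)`.  Then, under RH,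

  **`Q_{b₂}(u) ≤ (R_c(b₁) + 6Ws + (√J_c + e₁)²/((1 − 3s)(R_c(b₁) − L)) + 10η)·N`**,  `e₁ = (3/2)s(W + τ) + W√(2(b₂ − b₁))`.

Compared with the rate file (`WeilFarFloorCoshOptimalRateCoreRH`: `2(2J_c + 5s²(2W+τ)²)/(R − L)`) the second-order coefficient is now
EXACT: with `x = c²‖C_m‖²`, `y = ‖r‖²` the pieces give `Q ≤ R'x + 2|c|·B_x·√y + L·y + 10ηN` with the coupling bracket
`B_x ≤ √‖C‖²·(√J_c + e₁)` (coupling transfer, triangle inequality — no Young step) and `‖C_m‖² ≥ (1 − 3s)‖C‖²`, and the top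
eigenvalue of `[[R', B], [B, L]]` is `≤ R' + B²/(R' − L)`.  Taking `λ₀ = R_c(b₁)` makes `J_c` the residual energy
`J(b₁) = ‖1_{(−b₁,b₁)}(T_{b₁}C − R_cC)‖²/‖C‖²` of the second-order law (`WeilFarFloorSecondOrderLower` is the matching LOWER bound
`λ_max − R_c ≥ (J/R_c)(1 + Q(r)/(ρR_c))/(1 + J/R_c²)`); the floor version with budgets `s, h ≍ e^{−3a}, e^{−4a}` is
`WeilFarFloorSecondOrderUpperRH`.  Standard axioms only; RH enters as Mathlib's `RiemannHypothesis`.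
-/

set_option linter.dupNamespace false
set_option autoImplicit false

noncomputable section

open MeasureTheory Set Filter
open scoped Real Topology ArithmeticFunction.vonMangoldt

namespace Summit.RiemannHypothesis.RiemannHypothesis.Theorems.WeilFormatC

namespace FloorCoshSplit

open Literature.NumberTheory.LFunctions FloorCosh FloorEnvelope

/-! ## §1 Bookkeeping: the exact `2 × 2` block -/

/-- **The bookkeeping of the second-order estimate.**  With `x = c²‖C_m‖²`, `y = ‖r‖²`, `x + y = ∫u² ≤ N` and the pieces
`Q ≤ c²Q(C_m) + 2cX + 2P_o² − K y + ARCH`, `Q(C_m) ≤ R'‖C_m‖²`, `|X| ≤ B_x√y`, `B_x ≤ √P₁(√J_c + e₁)`, `‖C_m‖² ≥ (1−3s)P₁`,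
`2P_o² ≤ L_p y`, `ARCH ≤ θN + L_A y` and `L_p + L_A = L < R ≤ R'`:
`Q ≤ (R' + (√J_c + e₁)²/((1 − 3s)(R − L)) + θ)·N` — AM–GM on the coupling `2|c|B_x√y ≤ c²B_x²/(R − L) + (R − L)y`. -/
theorem secondOrder_bookkeeping {N Nu Pm P₁ R R' Q QCm c X Po ρr ARCH K θ Jc e₁ s L Lp LA Bx : ℝ}
    (hN : Nu ≤ N) (hR0 : 0 ≤ R) (hRR : R ≤ R') (hK0 : 0 ≤ K)
    (hs3 : 3 * s < 1) (hP₁0 : 0 < P₁) (hPm : (1 - 3 * s) * P₁ ≤ Pm) (hPm0 : 0 < Pm) (hgap : L < R) (hL : L = Lp + LA)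
    (hPyth : Nu = c ^ 2 * Pm + ρr) (hρr0 : 0 ≤ ρr) (hBx0 : 0 ≤ Bx)
    (F1 : Q ≤ c ^ 2 * QCm + 2 * c * X + 2 * Po ^ 2 - K * ρr + ARCH)
    (F3 : QCm ≤ R' * Pm)
    (F4 : |X| ≤ Bx * Real.sqrt ρr) (hBx : Bx ≤ Real.sqrt P₁ * (Real.sqrt Jc + e₁))
    (F5 : 2 * Po ^ 2 ≤ Lp * ρr) (F6 : ARCH ≤ θ * N + LA * ρr) :
    Q ≤ (R' + (Real.sqrt Jc + e₁) ^ 2 / ((1 - 3 * s) * (R - L)) + θ) * N := by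
  have hk : 0 < R - L := by linarith only [hgap]
  have h1s : 0 < 1 - 3 * s := by linarith only [hs3]
  have hc2 : 0 ≤ c ^ 2 := sq_nonneg c
  have hx0 : 0 ≤ c ^ 2 * Pm := mul_nonneg hc2 hPm0.le
  have hNu0 : 0 ≤ Nu := by rw [hPyth]; positivity
  have hN0 : 0 ≤ N := hNu0.trans hN
  set G := (Real.sqrt Jc + e₁) ^ 2 / ((1 - 3 * s) * (R - L)) with hG
  have hG0 : 0 ≤ G := by rw [hG]; positivity
  -- the coupling: `2cX ≤ 2|c|·Bx·√ρr ≤ (|c|Bx)²/(R − L) + (R − L)ρr`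
  set a := |c| * Bx with ha
  have ha0 : 0 ≤ a := by rw [ha]; positivity
  have hsρ0 : 0 ≤ Real.sqrt ρr := Real.sqrt_nonneg _
  have hsρ : Real.sqrt ρr ^ 2 = ρr := Real.sq_sqrt hρr0
  have hcX : 2 * c * X ≤ 2 * a * Real.sqrt ρr := by
    have h1 : c * X ≤ |c| * |X| := by rw [← abs_mul]; exact le_abs_self _
    have h2 : |c| * |X| ≤ |c| * (Bx * Real.sqrt ρr) := mul_le_mul_of_nonneg_left F4 (abs_nonneg c)
    rw [ha]; nlinarith only [h1, h2]
  have hamgm : 2 * a * Real.sqrt ρr ≤ a ^ 2 / (R - L) + (R - L) * ρr := by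
    have h0 : 0 ≤ (a - (R - L) * Real.sqrt ρr) ^ 2 := sq_nonneg _
    have h1 : 2 * a * ((R - L) * Real.sqrt ρr) ≤ a ^ 2 + (R - L) ^ 2 * ρr := by nlinarith only [h0, hsρ]
    have h2 : a ^ 2 / (R - L) + (R - L) * ρr = (a ^ 2 + (R - L) ^ 2 * ρr) / (R - L) := by
      field_simp
    rw [h2, le_div_iff₀ hk]
    nlinarith only [h1]
  -- `a² ≤ c²·P₁·(√Jc + e₁)² ≤ c²·Pm·(√Jc + e₁)²/(1 − 3s)`
  have ha2 : a ^ 2 ≤ c ^ 2 * Pm * (Real.sqrt Jc + e₁) ^ 2 / (1 - 3 * s) := by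
    have h1 : Bx ^ 2 ≤ (Real.sqrt P₁ * (Real.sqrt Jc + e₁)) ^ 2 := pow_le_pow_left₀ hBx0 hBx 2
    rw [mul_pow, Real.sq_sqrt hP₁0.le] at h1
    have h3 : P₁ ≤ Pm / (1 - 3 * s) := by rw [le_div_iff₀ h1s]; linarith only [hPm]
    have h4 : a ^ 2 = c ^ 2 * Bx ^ 2 := by rw [ha, mul_pow, sq_abs]
    rw [h4]
    have h5 : c ^ 2 * Bx ^ 2 ≤ c ^ 2 * (P₁ * (Real.sqrt Jc + e₁) ^ 2) := mul_le_mul_of_nonneg_left h1 hc2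
    have h6 : P₁ * (Real.sqrt Jc + e₁) ^ 2 ≤ Pm / (1 - 3 * s) * (Real.sqrt Jc + e₁) ^ 2 :=
      mul_le_mul_of_nonneg_right h3 (sq_nonneg _)
    have h7 := mul_le_mul_of_nonneg_left h6 hc2
    have e : c ^ 2 * (Pm / (1 - 3 * s) * (Real.sqrt Jc + e₁) ^ 2) = c ^ 2 * Pm * (Real.sqrt Jc + e₁) ^ 2 / (1 - 3 * s) := by
      field_simp
    linarith only [h5, h7, e.le, e.ge]
  have ha2k : a ^ 2 / (R - L) ≤ (c ^ 2 * Pm) * G := by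
    have e : (c ^ 2 * Pm) * G = (c ^ 2 * Pm * (Real.sqrt Jc + e₁) ^ 2 / (1 - 3 * s)) / (R - L) := by
      rw [hG]; field_simp
    rw [e]
    exact div_le_div_of_nonneg_right ha2 hk.le
  -- the profile component
  have hprof : c ^ 2 * QCm ≤ R' * (c ^ 2 * Pm) := by
    have h1 : c ^ 2 * QCm ≤ c ^ 2 * (R' * Pm) := mul_le_mul_of_nonneg_left F3 hc2
    linarith only [h1]
  have hK : -(K * ρr) ≤ 0 := by have := mul_nonneg hK0 hρr0; linarith only [this]
  -- collect: `Q ≤ (R' + G)x + R·y + θN ≤ (R' + G)·Nu + θN ≤ (R' + G + θ)·N`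
  have hsum : Q ≤ (R' + G) * (c ^ 2 * Pm) + R * ρr + θ * N := by
    have hy : (R - L) * ρr + Lp * ρr + LA * ρr = R * ρr := by rw [hL]; ring
    linarith only [F1, hprof, hcX, hamgm, ha2k, F5, F6, hK, hy]
  have hsplit : (R' + G) * (c ^ 2 * Pm) + R * ρr ≤ (R' + G) * Nu := by
    rw [hPyth]
    have : R * ρr ≤ (R' + G) * ρr := mul_le_mul_of_nonneg_right (by linarith only [hRR, hG0]) hρr0
    linarith only [this]
  have hR'0 : 0 ≤ R' + G := by linarith only [hR0, hRR, hG0]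
  have hNuN := mul_le_mul_of_nonneg_left hN hR'0
  have e : (R' + G + θ) * N = (R' + G) * N + θ * N := by ring
  rw [e]
  linarith only [hsum, hsplit, hNuN]

/-! ## §2 The second-order estimate for one Weil test -/

/-- **THE SECOND-ORDER UPPER BOUND FOR ONE WEIL TEST (under RH, abstract budgets).**  See the file header:
`Q_{b₂}(u) ≤ (R_c(b₁) + 6Ws + (√J_c + e₁)²/((1 − 3s)(R_c(b₁) − L)) + 10η)·N` with `e₁ = (3/2)s(W + τ) + W√(2(b₂ − b₁))`,
`L = 4(b₁ + sinh b₁ + 3)s² + 8(b₂ − b₁)P₊ + 4Ψ(ηh)`, for a real Weil test `u` on `[−b₂, b₂]` (`b₁ + s² ≤ b₂`, `b₁ ≥ 4`)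
with `∫u² ≤ N`, `D_t(u) ≤ (|t|/h)N`, and any approximate eigenvalue `0 ≤ λ₀ ≤ τ` of `C_{b₁}` with coupling budget `J_c`. -/
theorem primeShiftForm_le_coshQuotient_secondOrder_of_RH (hRH : RiemannHypothesis)
    {b₁ b₂ h η s N Jc W τ Pp : ℝ}
    (hb₁ : 4 ≤ b₁) (hb₁₂ : b₁ + s ^ 2 ≤ b₂)
    (hh0 : 0 < h) (hh1 : h ≤ 1) (hη0 : 0 < η) (hη1 : η ≤ 1) (hs0 : 0 < s) (hs1 : s ≤ 1 / 6)
    (hW : ∑ n ∈ weilPrimeIndex b₂, 2 * ((Λ n : ℝ) / Real.sqrt n) ≤ W)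
    {lam0 : ℝ} (hlam0 : 0 ≤ lam0) (hτ : lam0 ≤ τ) (hJc : 0 ≤ Jc)
    (hcoup : ∫ x in Ioo (-b₁) b₁,
        ((∑ n ∈ weilPrimeIndex b₁, (Λ n : ℝ) / Real.sqrt n *
            ((Icc (-b₁) b₁).indicator (fun y ↦ Real.cosh (y / 2)) (x - Real.log n)
              + (Icc (-b₁) b₁).indicator (fun y ↦ Real.cosh (y / 2)) (x + Real.log n)))
          - lam0 * (Icc (-b₁) b₁).indicator (fun y ↦ Real.cosh (y / 2)) x) ^ 2
        ≤ Jc * (b₁ + Real.sinh b₁))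
    (hPp : b₂ + Real.sinh b₂ ≤ Pp)
    (hgap : 4 * (b₁ + Real.sinh b₁ + 3) * s ^ 2 + 8 * (b₂ - b₁) * Pp + 4 * weilArchTail (η * h) + 1
        ≤ primeShiftForm b₁ ((Icc (-b₁) b₁).indicator (fun y ↦ Real.cosh (y / 2))) / (b₁ + Real.sinh b₁))
    {u : ℝ → ℝ} (hu : IsWeilTest fun x ↦ (u x : ℂ)) (hus : tsupport (fun x ↦ (u x : ℂ)) ⊆ Icc (-b₂) b₂)
    (huN : ∫ x, u x ^ 2 ≤ N) (hmod : ∀ t, ∫ x, (u (x + t) - u x) ^ 2 ≤ |t| / h * N) :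
    primeShiftForm b₂ u
      ≤ (primeShiftForm b₁ ((Icc (-b₁) b₁).indicator (fun y ↦ Real.cosh (y / 2))) / (b₁ + Real.sinh b₁) + 6 * W * s
          + (Real.sqrt Jc + (3 / 2 * s * (W + τ) + W * Real.sqrt (2 * (b₂ - b₁)))) ^ 2
            / ((1 - 3 * s) * (primeShiftForm b₁ ((Icc (-b₁) b₁).indicator (fun y ↦ Real.cosh (y / 2))) / (b₁ + Real.sinh b₁)
              - (4 * (b₁ + Real.sinh b₁ + 3) * s ^ 2 + 8 * (b₂ - b₁) * Pp + 4 * weilArchTail (η * h))))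
          + 10 * η) * N := by
  classical
  /- ─── constants ─── -/
  set I := ∫ t in Ioi (0 : ℝ), (Real.exp (t / 2) - 1) / (2 * Real.sinh t) with hI
  have hI0 : 0 ≤ I := setIntegral_nonneg measurableSet_Ioi fun t ht ↦ weilKillingDensity_nonneg ht
  have hL0 : 0 ≤ Real.log (4 * π) + Real.eulerMascheroniConstant := by
    have h2 : 0 ≤ Real.log (4 * π) := Real.log_nonneg (by linarith only [Real.pi_gt_three])
    linarith only [h2, Real.one_half_lt_eulerMascheroniConstant]
  set K := 2 * I + (Real.log (4 * π) + Real.eulerMascheroniConstant) with hKdef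
  have hK0 : 0 ≤ K := by rw [hKdef]; linarith only [hI0, hL0]
  clear_value I K
  have hs2 : 0 < s ^ 2 := by positivity
  have hb₁0 : 0 < b₁ := by linarith only [hb₁]
  have hb₁1 : 1 ≤ b₁ := by linarith only [hb₁]
  have hb₁₂' : b₁ ≤ b₂ := by linarith only [hb₁₂, hs2]
  have hd0 : 0 ≤ b₂ - b₁ := by linarith only [hb₁₂']
  have hsinh1 : b₁ ≤ Real.sinh b₁ := Real.self_le_sinh_iff.2 hb₁0.le
  have hN : 0 ≤ N := (integral_nonneg fun x ↦ sq_nonneg (u x)).trans huN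
  have hs36 : s ^ 2 ≤ 1 / 36 := by nlinarith only [hs0, hs1]
  have hs21 : s ^ 2 ≤ 1 := by linarith only [hs36]
  have hs3 : 3 * s < 1 := by linarith only [hs1]
  have hW0 : 0 ≤ W := le_trans (Finset.sum_nonneg fun n _ ↦
    mul_nonneg (by norm_num) (div_nonneg ArithmeticFunction.vonMangoldt_nonneg (Real.sqrt_nonneg _))) hW
  have hτ0 : 0 ≤ τ := hlam0.trans hτ
  -- the cut `t₀ = ηh`
  set t₀ := η * h with ht₀def
  have ht₀ : 0 < t₀ := by positivity
  have hΨ0 : 0 ≤ weilArchTail t₀ := (weilArchTail_pos ht₀).le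
  have hPp0 : 0 ≤ Pp := le_trans (by
    have := Real.self_le_sinh_iff.2 (hb₁0.le.trans hb₁₂'); linarith only [this, hb₁0, hb₁₂']) hPp
  /- ─── the test `u` ─── -/
  obtain ⟨-, hum, ⟨Cu, hCu⟩, hus0⟩ := weilTest_admissible hu hus
  /- ─── the cosh profile `C` of the window `b₁` ─── -/
  obtain ⟨hCm_, hCb, hCs⟩ := coshTest_admissible b₁
  have hCP : ∫ x, (Icc (-b₁) b₁).indicator (fun y ↦ Real.cosh (y / 2)) x ^ 2 = b₁ + Real.sinh b₁ :=
    integral_coshTest_sq hb₁0.le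
  obtain ⟨Cm, hCmW, hCmT, hCmm, hCmb, hCms, hCmN, hCmD, hCmnear⟩ := exists_smoothProfile b₁ hs2
  have hdist : ∫ x, (Cm x - (Icc (-b₁) b₁).indicator (fun y ↦ Real.cosh (y / 2)) x) ^ 2
      ≤ (b₁ + Real.sinh b₁ + 3) * s ^ 2 :=
    hCmnear _ fun y hy ↦ coshTest_modulus_le hb₁1 hs21 hy
  have hmodC : ∀ t ∈ Ioc (0 : ℝ) 1, ∫ x, ((Icc (-b₁) b₁).indicator (fun y ↦ Real.cosh (y / 2)) (x + t)
      - (Icc (-b₁) b₁).indicator (fun y ↦ Real.cosh (y / 2)) x) ^ 2 ≤ (b₁ + Real.sinh b₁ + 3) * t :=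
    fun t ht ↦ coshTest_increment_le_linear hb₁1 ht.1.le ht.2
  set P₁ := b₁ + Real.sinh b₁ with hP₁
  have hP₁3 : 3 ≤ P₁ := by rw [hP₁]; linarith only [hsinh1, hb₁]
  have hP₁0 : 0 < P₁ := by linarith only [hP₁3]
  have hdist₀ : ∫ x, ((Icc (-b₁) b₁).indicator (fun y ↦ Real.cosh (y / 2)) x - Cm x) ^ 2 ≤ (P₁ + 3) * s ^ 2 := by
    have e : ∫ x, ((Icc (-b₁) b₁).indicator (fun y ↦ Real.cosh (y / 2)) x - Cm x) ^ 2
        = ∫ x, (Cm x - (Icc (-b₁) b₁).indicator (fun y ↦ Real.cosh (y / 2)) x) ^ 2 :=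
      integral_congr_ae (Eventually.of_forall fun x ↦ by simp only; ring)
    rw [e]; exact hdist
  -- support extensions to the test window `b₂`
  have hCms₂ : ∀ x, x ∉ Icc (-b₂) b₂ → Cm x = 0 := fun x hx ↦ hCms x fun hm ↦ hx
    ⟨by linarith only [hm.1, hb₁₂], by linarith only [hm.2, hb₁₂]⟩
  have hCmT₂ : tsupport (fun x ↦ (Cm x : ℂ)) ⊆ Icc (-b₂) b₂ :=
    hCmT.trans (Icc_subset_Icc (by linarith only [hb₁₂]) hb₁₂)
  set C : ℝ → ℝ := (Icc (-b₁) b₁).indicator (fun y ↦ Real.cosh (y / 2)) with hCdef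
  set Nu := ∫ x, u x ^ 2 with hNu
  have hNu0 : 0 ≤ Nu := by rw [hNu]; exact integral_nonneg fun x ↦ sq_nonneg (u x)
  have hCs₂ : ∀ x, x ∉ Icc (-b₂) b₂ → C x = 0 := fun x hx ↦ hCs x fun hm ↦ hx
    ⟨by linarith only [hm.1, hb₁₂'], by linarith only [hm.2, hb₁₂']⟩
  set R := primeShiftForm b₁ C / P₁ with hR
  -- the complement ceiling `L` and the sign of `R`
  set Lp := 4 * (P₁ + 3) * s ^ 2 + 8 * (b₂ - b₁) * Pp with hLp
  have hLp0 : 0 ≤ Lp := by rw [hLp]; positivity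
  set L := Lp + 4 * weilArchTail t₀ with hL
  have hgap' : L < R := by rw [hL, hLp]; linarith only [hgap]
  have hR0 : 0 ≤ R := by
    have : 0 ≤ L := by rw [hL]; positivity
    linarith only [this, hgap']
  clear_value P₁ C Nu R
  have hsqd : Real.sqrt (∫ x, (Cm x - C x) ^ 2) ≤ 3 / 2 * s * Real.sqrt P₁ := sqrt_le_of_le_mul_sq hP₁3 hs0.le hdist
  have hsqd' : Real.sqrt (∫ x, (C x - Cm x) ^ 2) ≤ 3 / 2 * s * Real.sqrt P₁ := sqrt_le_of_le_mul_sq hP₁3 hs0.le hdist₀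
  -- the norm of `Cm`: `(1 − 3s)P₁ ≤ Pm ≤ P₁`
  set Pm := ∫ x, Cm x ^ 2 with hPm
  have hCmN' : ∫ x, Cm x ^ 2 ≤ ∫ x, C x ^ 2 := by rw [← hPm]; exact hCmN
  have hPmlb : (1 - 3 * s) * P₁ ≤ Pm := by
    have h1 := integral_sq_ge_of_near (B := b₂) hCm_ hCmm hCb hCmb hCs₂ hCms₂ hCmN'
    rw [hCP, ← hPm] at h1
    have hsP : Real.sqrt P₁ * Real.sqrt P₁ = P₁ := Real.mul_self_sqrt hP₁0.le
    have h2 : 2 * Real.sqrt P₁ * Real.sqrt (∫ x, (C x - Cm x) ^ 2) ≤ 3 * s * P₁ := by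
      calc 2 * Real.sqrt P₁ * Real.sqrt (∫ x, (C x - Cm x) ^ 2) ≤ 2 * Real.sqrt P₁ * (3 / 2 * s * Real.sqrt P₁) :=
            mul_le_mul_of_nonneg_left hsqd' (by positivity)
        _ = 3 * s * (Real.sqrt P₁ * Real.sqrt P₁) := by ring
        _ = 3 * s * P₁ := by rw [hsP]
    linarith only [h1, h2]
  have hPm2 : P₁ ≤ 2 * Pm := by nlinarith only [hPmlb, hs1, hP₁0]
  have hPm0 : 0 < Pm := by linarith only [hPm2, hP₁0]
  clear_value Pm
  have hPm0' : 0 < ∫ x, Cm x ^ 2 := by rw [← hPm]; exact hPm0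
  have hPmne : (∫ x, Cm x ^ 2) ≠ 0 := hPm0'.ne'
  /- ─── the decomposition `u = c·Cm + r` inside the window `b₂` ─── -/
  set c := (∫ y, u y * Cm y) / Pm with hc
  clear_value c
  obtain ⟨hrm, hrb, hrs⟩ := residual_admissible (B := b₂) hum hCmm hCu hCmb hus0 hCms₂ c
  have hrW : IsWeilTest fun x ↦ ((u x - c * Cm x : ℝ) : ℂ) := by
    have e : (fun x ↦ ((u x - c * Cm x : ℝ) : ℂ)) = (fun x ↦ ((-c : ℝ) : ℂ) * (Cm x : ℂ)) + fun x ↦ (u x : ℂ) := by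
      funext x; simp only [Pi.add_apply]; push_cast; ring
    rw [e]; exact (hCmW.const_mul _).add hu
  have hrT : tsupport (fun x ↦ ((u x - c * Cm x : ℝ) : ℂ)) ⊆ Icc (-b₂) b₂ := by
    refine closure_minimal (fun x hx ↦ ?_) isClosed_Icc
    by_contra h'
    exact hx (by simp [hrs x h'])
  -- Bessel and orthogonality
  obtain ⟨hBes, -⟩ := profile_energy_le (B := b₂) hum hCmm hCu hCmb hus0 hCms₂ hPmne
  rw [← hPm, ← hc, ← hNu] at hBes
  have horth : ∫ x, Cm x * (u x - c * Cm x) = 0 := by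
    have h' := integral_profile_mul_residual (B := b₂) hum hCmm hCu hCmb hus0 hCms₂ hPmne
    rwa [← hPm, ← hc] at h'
  /- ─── the pieces ─── -/
  -- (F1) the structural step under RH
  obtain ⟨-, hstruct⟩ := primeShiftForm_le_profile_add_residual_of_RH hRH hu hus hCmW hCmT₂
  rw [← hPm, ← hc, ← hI, ← hKdef] at hstruct
  -- (F3) the profile component
  have hF3 := profile_term_le hb₁₂' hs0.le hP₁0 hW0 hCm_ hCb hCs hCmm hCmb hCms₂ hCP hPm0' hCmN' hsqd' hW
  rw [← hPm, ← hR] at hF3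
  -- (F5) the pole leakage across the nested windows
  have hF5 := pole_leak_le (s := s) (P₁ := P₁) hb₁1 hb₁₂' hPp hCmm hCmb hCms₂ hum hCu hus0 hPmne
    (by rw [← hCdef]; exact hdist₀)
  rw [← hPm, ← hc] at hF5
  -- (F6) the archimedean energy of the residual
  have hmodf : ∀ t ∈ Ioc (0 : ℝ) 1, ∫ x, (Cm (x + t) - Cm x) ^ 2 ≤ (P₁ + 3) * t := fun t ht ↦
    (hCmD t).trans (hmodC t ht)
  have hF6 := arch_term_le hh0 hh1 hη0 hη1 hP₁3 hCmm hCmb hCms₂ hum hCu hus0 hrW hrT hmod hmodf hN huN hNu0 hBes hPm2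
  rw [← ht₀def] at hF6
  -- Pythagoras `Nu = c²Pm + ρr`
  have hPyth := integral_sq_eq_profile_add_residual (B := b₂) hum hCmm hCu hCmb hus0 hCms₂ hPmne
  rw [← hPm, ← hc, ← hNu] at hPyth
  -- (F4) the coupling transfer: `|X| ≤ Bx·√ρr`, `Bx ≤ √P₁(√Jc + e₁)`
  have hct := abs_integral_primeShiftOp_mul_le (b := b₁) (b' := b₂) hb₁₂' hCm_ hCb hCs hCmm hCmb hCms₂ hrm hrb hrs horth
    lam0
  have hA₂W : 2 * (∑ n ∈ weilPrimeIndex b₂, (Λ n : ℝ) / Real.sqrt n) ≤ W := by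
    rw [Finset.mul_sum]; exact hW
  have hA₂0 : 0 ≤ ∑ n ∈ weilPrimeIndex b₂, (Λ n : ℝ) / Real.sqrt n :=
    Finset.sum_nonneg fun n _ ↦ div_nonneg ArithmeticFunction.vonMangoldt_nonneg (Real.sqrt_nonneg _)
  have hcoupS : Real.sqrt (∫ x in Ioo (-b₁) b₁, ((∑ n ∈ weilPrimeIndex b₁, (Λ n : ℝ) / Real.sqrt n *
          (C (x - Real.log n) + C (x + Real.log n))) - lam0 * C x) ^ 2)
      ≤ Real.sqrt Jc * Real.sqrt P₁ := by
    rw [← Real.sqrt_mul hJc]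
    exact Real.sqrt_le_sqrt hcoup
  have hcosh : Real.cosh (b₁ / 2) ≤ Real.sqrt P₁ := by rw [hP₁]; exact cosh_half_le_sqrt hb₁1
  have habsτ : |lam0| = lam0 := abs_of_nonneg hlam0
  rw [habsτ] at hct
  have h1 : (2 * (∑ n ∈ weilPrimeIndex b₂, (Λ n : ℝ) / Real.sqrt n) + lam0)
      * Real.sqrt (∫ x, (Cm x - C x) ^ 2) ≤ (W + τ) * (3 / 2 * s * Real.sqrt P₁) :=
    mul_le_mul (by linarith only [hA₂W, hτ]) hsqd (Real.sqrt_nonneg _) (by positivity)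
  have h2 : 2 * (∑ n ∈ weilPrimeIndex b₂, (Λ n : ℝ) / Real.sqrt n) * Real.cosh (b₁ / 2) * Real.sqrt (2 * (b₂ - b₁))
      ≤ W * Real.sqrt P₁ * Real.sqrt (2 * (b₂ - b₁)) :=
    mul_le_mul_of_nonneg_right (mul_le_mul hA₂W hcosh (Real.cosh_pos _).le hW0) (Real.sqrt_nonneg _)
  generalize hBx : Real.sqrt (∫ x in Ioo (-b₁) b₁, ((∑ n ∈ weilPrimeIndex b₁, (Λ n : ℝ) / Real.sqrt n *
          (C (x - Real.log n) + C (x + Real.log n))) - lam0 * C x) ^ 2)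
        + (2 * (∑ n ∈ weilPrimeIndex b₂, (Λ n : ℝ) / Real.sqrt n) + lam0)
          * Real.sqrt (∫ x, (Cm x - C x) ^ 2)
        + 2 * (∑ n ∈ weilPrimeIndex b₂, (Λ n : ℝ) / Real.sqrt n) * Real.cosh (b₁ / 2)
          * Real.sqrt (2 * (b₂ - b₁)) = Bx at hct
  have hBx1 : Bx ≤ Real.sqrt P₁ * (Real.sqrt Jc + (3 / 2 * s * (W + τ) + W * Real.sqrt (2 * (b₂ - b₁)))) := by
    rw [← hBx]
    have e : Real.sqrt P₁ * (Real.sqrt Jc + (3 / 2 * s * (W + τ) + W * Real.sqrt (2 * (b₂ - b₁))))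
        = Real.sqrt Jc * Real.sqrt P₁ + (W + τ) * (3 / 2 * s * Real.sqrt P₁)
          + W * Real.sqrt P₁ * Real.sqrt (2 * (b₂ - b₁)) := by ring
    rw [e]
    linarith only [hcoupS, h1, h2]
  have hBx0 : 0 ≤ Bx := by rw [← hBx]; positivity
  clear h1 h2 hcoupS hcosh hBx
  generalize hX : (∫ x, (∑ n ∈ weilPrimeIndex b₂, (Λ n : ℝ) / Real.sqrt n
      * (Cm (x - Real.log n) + Cm (x + Real.log n))) * (u x - c * Cm x)) = X at hct hstruct
  generalize hρr : (∫ x, (u x - c * Cm x) ^ 2) = ρr at hct hstruct hF5 hF6 hPyth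
  have hρr0 : 0 ≤ ρr := by rw [← hρr]; exact integral_nonneg fun x ↦ sq_nonneg _
  have hF5' : 2 * (∫ t, (u t - c * Cm t) * Real.cosh (t / 2)) ^ 2 ≤ Lp * ρr := by
    rw [hLp]; nlinarith only [hF5, hρr0, hLp0]
  /- ─── bookkeeping: the exact block `[[R', B], [B, L]]` ─── -/
  have hRR : R ≤ R + 6 * W * s := by nlinarith only [hW0, hs0]
  exact secondOrder_bookkeeping (θ := 10 * η) (e₁ := 3 / 2 * s * (W + τ) + W * Real.sqrt (2 * (b₂ - b₁)))
    huN hR0 hRR hK0 hs3 hP₁0 hPmlb hPm0 hgap' hL hPyth hρr0 hBx0 hstruct hF3 hct hBx1 hF5' hF6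

end FloorCoshSplit

end Summit.RiemannHypothesis.RiemannHypothesis.Theorems.WeilFormatC
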